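import Literature.Claims.NS.Ruzmaikina2008
import HarnessLib

/-!
# Solo salvage for claim C25 `Ruzmaikina2008`, Step 8 (Part 2 of the proof of Theorem 2, scalar grain)

Claim skeleton: `Literature/Claims/NS/Ruzmaikina2008.lean` (claim C25, cell `ns-claims`, D-0090; adjudicated
#39, first failing step `Inference50` (50) p.20, class false lemma). Companion of
`Theorems/SoloSalvageRuzmaikina2008.lean` (Steps 6 `Ineq48` and `ClayDelta`); this file (seat
`ns-claims-salvage-p3`) adds the last scalar step:

* `ruzmaikina2008_part2_holds : Part2` — proof of Thm 2, Part 2, (53)–(58) p.21–22 at the scalar grain: for a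
  continuous `f ≥ 0` on `[t₁,t₂]`, if the Part-1 bound `f(t) ≤ e^{(1/n)e^{e^{t−a}}} f(a)` holds on every
  sub-interval `[a,b]` where `f ≥ e^e`, then `f(t) ≤ e^{(1/n)e^{e^{t₂−t₁}}} max(f(t₁), e^e)` on `[t₁,t₂]`.
  Real analysis: the last entry time `a = sup{s ∈ [t₁,t] : f(s) < e^e}` and continuity give `f(a) = e^e`.
  Downstream of the locator; with the skeleton's `gronwall47_holds`, `integration_holds` and
  `ruzmaikina2008_ineq48_holds` every scalar step (3, 4, 6, 8) of the argument is kernel-TRUE — the failure is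
  exactly the vector step (50).

Solo lane (`Theorems/SoloSalvage<Slug>*.lean`, no item).

WHAT THIS IS NOT: not a claim about NS regularity or blow-up; not a claim about any author beyond the
typed locator.
-/

noncomputable section

-- The summit-side namespace repeats the summit name by design (D-0017 layout); tree precedent
-- `SoloSalvageLam2019.lean`.
set_option linter.dupNamespace false

open Set Filter Topology

namespace Summit.NavierStokesRegularity.NavierStokesRegularity.Theorems.Ruzmaikina2008Salvage



/-- **Step 8 — Part 2, (53)–(58) p.21–22, holds (scalar grain)**: let `f` be continuous and nonnegative on
`[t₁,t₂]` and suppose that on every `[a,b] ⊆ [t₁,t₂]` on which `f ≥ e^e` the Part-1 bound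
`f(t) ≤ e^{(1/n)e^{e^{t−a}}} f(a)` holds. Then `f(t) ≤ e^{(1/n)e^{e^{t₂−t₁}}} max(f(t₁), e^e)` on `[t₁,t₂]`.
Proof: if `f(t) < e^e` there is nothing to show; otherwise let `a = sup{s ∈ [t₁,t] : f(s) < e^e}` (or
`a = t₁` if that set is empty); by continuity `f(a) = e^e` (resp. `f ≥ e^e` on `[t₁,t]`), `f ≥ e^e` on
`[a,t]`, and the Part-1 bound on `[a,t]` gives the claim by monotonicity of the exponent. -/
theorem ruzmaikina2008_part2_holds : Literature.Claims.NS.Ruzmaikina2008.Part2 := by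
  intro n t₁ t₂ f _hn ht12 hfc hf0 H t ht
  set E : ℝ := Real.exp (Real.exp 1) with hEdef
  set Φ : ℝ → ℝ := fun s => Real.exp ((1 / (n : ℝ)) * Real.exp (Real.exp s)) with hΦ
  have hE0 : 0 < E := Real.exp_pos _
  have hΦ1 : ∀ s, 1 ≤ Φ s := fun s => Real.one_le_exp (by positivity)
  have hΦmono : ∀ s s', s ≤ s' → Φ s ≤ Φ s' := fun s s' hss' => by
    simp only [hΦ]
    gcongr
  have hmaxE : E ≤ max (f t₁) E := le_max_right _ _
  have hmax0 : 0 ≤ max (f t₁) E := hE0.le.trans hmaxE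
  show f t ≤ Φ (t₂ - t₁) * max (f t₁) E
  -- the easy case `f t < e^e`
  by_cases hft : f t < E
  · exact hft.le.trans (hmaxE.trans (le_mul_of_one_le_left hmax0 (hΦ1 _)))
  push Not at hft
  -- from a bound `Φ (t - a) * c` with `t₁ ≤ a`, `c ≤ max (f t₁) E`, `0 ≤ c`
  have finish : ∀ a c : ℝ, t₁ ≤ a → 0 ≤ c → c ≤ max (f t₁) E → f t ≤ Φ (t - a) * c →
      f t ≤ Φ (t₂ - t₁) * max (f t₁) E := by
    intro a c ha hc0 hc hb
    refine hb.trans ?_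
    exact mul_le_mul (hΦmono _ _ (by linarith [ht.2])) hc hc0 (le_trans zero_le_one (hΦ1 _))
  -- the set of times before `t` where `f < e^e`
  set S : Set ℝ := {s | s ∈ Icc t₁ t ∧ f s < E} with hS
  by_cases hSe : S = ∅
  · -- `f ≥ e^e` on `[t₁, t]`
    have hge : ∀ s ∈ Icc t₁ t, E ≤ f s := by
      intro s hs
      by_contra hlt
      have : s ∈ S := ⟨hs, lt_of_not_ge hlt⟩
      rw [hSe] at this
      exact this
    rcases ht.1.eq_or_lt with h0 | h0
    · -- `t = t₁`
      rw [← h0]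
      exact (le_max_left _ _).trans (le_mul_of_one_le_left hmax0 (hΦ1 _))
    · exact finish t₁ (f t₁) le_rfl (hf0 t₁ ⟨le_rfl, ht12.le⟩) (le_max_left _ _)
        (H t₁ t le_rfl h0 ht.2 hge t ⟨h0.le, le_rfl⟩)
  · -- the last entry time `a = sup S`
    have hSne : S.Nonempty := Set.nonempty_iff_ne_empty.2 hSe
    have hSbdd : BddAbove S := ⟨t, fun s hs => hs.1.2⟩
    set a : ℝ := sSup S with ha
    obtain ⟨s₀, hs₀⟩ := hSne
    have hat : a ≤ t := csSup_le ⟨s₀, hs₀⟩ fun s hs => hs.1.2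
    have hta : t₁ ≤ a := hs₀.1.1.trans (le_csSup hSbdd hs₀)
    have haI : a ∈ Icc t₁ t₂ := ⟨hta, hat.trans ht.2⟩
    -- after `a`, `f ≥ e^e`
    have hafter : ∀ s, a < s → s ≤ t → E ≤ f s := by
      intro s has hst
      by_contra hlt
      have hsS : s ∈ S := ⟨⟨hta.trans has.le, hst⟩, lt_of_not_ge hlt⟩
      exact (not_le.2 has) (le_csSup hSbdd hsS)
    -- `f a ≤ e^e`
    have hfa_le : f a ≤ E := by
      by_contra hlt
      push Not at hlt
      have hev : ∀ᶠ s in 𝓝[Icc t₁ t₂] a, E < f s := (hfc a haI).eventually (lt_mem_nhds hlt)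
      rw [eventually_nhdsWithin_iff, Metric.eventually_nhds_iff] at hev
      obtain ⟨δ, hδ, hδp⟩ := hev
      obtain ⟨s, hsS, hs⟩ := exists_lt_of_lt_csSup ⟨s₀, hs₀⟩ (show a - δ < sSup S by linarith)
      have hsa : s ≤ a := le_csSup hSbdd hsS
      have hdist : dist s a < δ := by
        rw [Real.dist_eq, abs_sub_lt_iff]
        constructor <;> linarith
      exact (lt_irrefl E) ((hδp hdist ⟨hsS.1.1, hsS.1.2.trans ht.2⟩).trans hsS.2)
    rcases hat.eq_or_lt with hEq | hlt
    · -- `a = t`: then `f t = e^e`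
      have hfe : f t = E := le_antisymm (hEq ▸ hfa_le) hft
      rw [hfe]
      exact hmaxE.trans (le_mul_of_one_le_left hmax0 (hΦ1 _))
    · -- `a < t`: `f a ≥ e^e` by continuity from the right, then the Part-1 bound on `[a, t]`
      have hfa_ge : E ≤ f a := by
        have hcw : ContinuousWithinAt f (Ioo a t) a :=
          (hfc a haI).mono fun s hs => ⟨hta.trans hs.1.le, hs.2.le.trans ht.2⟩
        haveI : (𝓝[Ioo a t] a).NeBot := by
          apply mem_closure_iff_nhdsWithin_neBot.mp
          rw [closure_Ioo hlt.ne]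
          exact ⟨le_rfl, hlt.le⟩
        refine ge_of_tendsto hcw.tendsto ?_
        filter_upwards [self_mem_nhdsWithin] with s hs
        exact hafter s hs.1 hs.2.le
      have hge : ∀ s ∈ Icc a t, E ≤ f s := by
        intro s hs
        rcases hs.1.eq_or_lt with h0 | h0
        · rw [← h0]; exact hfa_ge
        · exact hafter s h0 hs.2
      have hb := H a t hta hlt ht.2 hge t ⟨hlt.le, le_rfl⟩
      exact finish a (f a) hta (hf0 a haI) (hfa_le.trans hmaxE) hb

end Summit.NavierStokesRegularity.NavierStokesRegularity.Theorems.Ruzmaikina2008Salvage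

end
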